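import Mathlib
import HarnessLib

/-!
# Stub `stub_bernsteinKernel` (A2) of line `Sketch` (idea `return-flow-bernstein`)
(crux `CageBudgetFekete.QuasiSuperadditiveHeatVariance`, item stmt-AtomisticToContinuum-15769; `--supports` file,
closes nothing)

WHAT. The registered stub A2 of the crux skeleton
(`Cruxes/QuasiSuperadditiveHeatVariance/Lines/Sketch.lean`): for a finite measure `m` on `ℝ` carried by `(0,∞)`
(`m`-a.e. `λ > 0`) with `λ⁻² ∈ L¹(m)`, the Bernstein (return-flow) kernel `K(w) = ∫ e^{-λ|w|} dm(λ)` is continuous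
and its double window integral obeys the cage budget `∫₀ˢ ∫ᵤ^{u+t} K ≤ ∫ λ⁻² dm` for all `s, t ≥ 0`.

HOW. Pure real analysis. Since `λ > 0` `m`-a.e., `K(w) = ∫ e^{-|λw|} dm(λ)`, an integrand bounded by `1`
everywhere; continuity is dominated continuity of a parametric Bochner integral (`continuous_of_dominated`).
For the budget: shift `∫ᵤ^{u+t} K = ∫₀ᵗ K(· + u)`, swap the `m`-integral outside both Lebesgue integrals
(`intervalIntegral_integral_swap`, integrands bounded by `1` resp. `t` on finite product measures), evaluate
`∫₀ˢ ∫₀ᵗ e^{-λ(w+u)} dw du = (1 - e^{-λs})(1 - e^{-λt}) / λ²` for `λ > 0` by the FTC, and bound by `λ⁻²`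
(`integral_mono_of_nonneg`).
-/

noncomputable section

namespace Summit.AtomisticToContinuum.FouriersLaw.Theorems.QuasiSuperadditiveHeatVariance.ReturnFlowBernstein

open MeasureTheory Filter Set Function intervalIntegral
open scoped Topology

/-- `e^{-|x|} ≤ 1`. [folklore] -/
theorem exp_neg_abs_le_one (x : ℝ) : Real.exp (-|x|) ≤ 1 :=
  Real.exp_le_one_iff.mpr (neg_nonpos.mpr (abs_nonneg x))

/-- `‖e^{-|x|}‖ ≤ 1`. [folklore] -/
theorem norm_exp_neg_abs_le_one (x : ℝ) : ‖Real.exp (-|x|)‖ ≤ 1 := by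
  rw [Real.norm_eq_abs, abs_of_pos (Real.exp_pos _)]
  exact exp_neg_abs_le_one x

/-- FTC evaluation `∫ₐᵇ e^{-lx} dx = (e^{-la} - e^{-lb}) / l` for `l ≠ 0`. [folklore] -/
theorem integral_exp_neg_mul {l : ℝ} (hl : l ≠ 0) (a b : ℝ) :
    ∫ x in a..b, Real.exp (-(l * x)) = (Real.exp (-(l * a)) - Real.exp (-(l * b))) / l := by
  have hderiv : ∀ x ∈ uIcc a b,
      HasDerivAt (fun x : ℝ => -Real.exp (-(l * x)) / l) (Real.exp (-(l * x))) x := by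
    intro x _
    have h1 : HasDerivAt (fun x : ℝ => Real.exp (-(l * x))) (-l * Real.exp (-(l * x))) x :=
      (((hasDerivAt_id' x).const_mul l).fun_neg.exp).congr_deriv (by ring)
    exact (h1.fun_neg.div_const l).congr_deriv (by field_simp)
  rw [integral_eq_sub_of_hasDerivAt hderiv
    ((by fun_prop : Continuous fun x : ℝ => Real.exp (-(l * x))).intervalIntegrable a b)]
  field_simp
  ring

/-- Shift of the moving window: `∫ᵤ^{u+t} f = ∫₀ᵗ f(· + u)`. [folklore] -/
theorem integral_window_shift (f : ℝ → ℝ) (u t : ℝ) :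
    ∫ w in u..(u + t), f w = ∫ w in (0:ℝ)..t, f (w + u) := by
  rw [intervalIntegral.integral_comp_add_right, zero_add, add_comm t u]

/-- Continuity of the Bernstein kernel `w ↦ ∫ e^{-|λw|} dm(λ)` for a finite measure `m`
(dominated continuity, bound `1`). [folklore] -/
theorem continuous_kernel (m : Measure ℝ) [IsFiniteMeasure m] :
    Continuous (fun w : ℝ => ∫ l, Real.exp (-|l * w|) ∂m) := by
  refine continuous_of_dominated (bound := fun _ => (1:ℝ)) ?_ ?_ (integrable_const _) ?_
  · intro w
    exact (by fun_prop : Continuous fun l : ℝ => Real.exp (-|l * w|)).aestronglyMeasurable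
  · intro w
    exact Eventually.of_forall fun l => norm_exp_neg_abs_le_one _
  · exact Eventually.of_forall fun l => by fun_prop

/-- Inner Tonelli swap: `∫₀ᵗ ∫ e^{-|λ(w+u)|} dm dw = ∫ ∫₀ᵗ e^{-|λ(w+u)|} dw dm` (integrand bounded by `1` on a
finite product measure). [folklore] -/
theorem inner_swap (m : Measure ℝ) [IsFiniteMeasure m] {t : ℝ} (ht : 0 ≤ t) (u : ℝ) :
    ∫ w in (0:ℝ)..t, ∫ l, Real.exp (-|l * (w + u)|) ∂m
      = ∫ l, (∫ w in (0:ℝ)..t, Real.exp (-|l * (w + u)|)) ∂m := by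
  refine intervalIntegral_integral_swap ?_
  rw [uIoc_of_le ht]
  refine (integrable_const (1:ℝ)).mono' ?_ (Eventually.of_forall fun p => norm_exp_neg_abs_le_one _)
  exact (by fun_prop : Continuous fun p : ℝ × ℝ => Real.exp (-|p.2 * (p.1 + u)|)).aestronglyMeasurable

/-- Outer Tonelli swap: `∫₀ˢ ∫ (∫₀ᵗ e^{-|λ(w+u)|} dw) dm du = ∫ ∫₀ˢ ∫₀ᵗ e^{-|λ(w+u)|} dw du dm` (integrand
bounded by `t` on a finite product measure; joint continuity of the parametric interval integral). [folklore] -/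
theorem outer_swap (m : Measure ℝ) [IsFiniteMeasure m] {s t : ℝ} (hs : 0 ≤ s) (ht : 0 ≤ t) :
    ∫ u in (0:ℝ)..s, ∫ l, (∫ w in (0:ℝ)..t, Real.exp (-|l * (w + u)|)) ∂m
      = ∫ l, (∫ u in (0:ℝ)..s, ∫ w in (0:ℝ)..t, Real.exp (-|l * (w + u)|)) ∂m := by
  refine intervalIntegral_integral_swap ?_
  rw [uIoc_of_le hs]
  refine (integrable_const t).mono' ?_ (Eventually.of_forall fun p => ?_)
  · have hc : Continuous fun p : ℝ × ℝ => ∫ w in (0:ℝ)..t, Real.exp (-|p.2 * (w + p.1)|) :=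
      intervalIntegral.continuous_parametric_intervalIntegral_of_continuous' (by fun_prop) 0 t
    exact hc.aestronglyMeasurable
  · have h := intervalIntegral.norm_integral_le_of_norm_le_const (a := 0) (b := t) (C := 1)
      (f := fun w : ℝ => Real.exp (-|p.2 * (w + p.1)|)) (fun x _ => norm_exp_neg_abs_le_one _)
    change ‖∫ w in (0:ℝ)..t, Real.exp (-|p.2 * (w + p.1)|)‖ ≤ t
    refine h.trans_eq ?_
    rw [sub_zero, one_mul, abs_of_nonneg ht]

/-- Closed form for `λ > 0`, `s, t ≥ 0`:
`∫₀ˢ ∫₀ᵗ e^{-|λ(w+u)|} dw du = (1 - e^{-λs})/λ · (1 - e^{-λt})/λ`. [folklore] -/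
theorem double_integral_closed_form {l s t : ℝ} (hl : 0 < l) (hs : 0 ≤ s) (ht : 0 ≤ t) :
    ∫ u in (0:ℝ)..s, ∫ w in (0:ℝ)..t, Real.exp (-|l * (w + u)|)
      = (1 - Real.exp (-(l * s))) / l * ((1 - Real.exp (-(l * t))) / l) := by
  have h1 : EqOn (fun u : ℝ => ∫ w in (0:ℝ)..t, Real.exp (-|l * (w + u)|))
      (fun u : ℝ => Real.exp (-(l * u)) * ((1 - Real.exp (-(l * t))) / l)) (uIcc 0 s) := by
    intro u hu
    rw [uIcc_of_le hs] at hu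
    have h2 : EqOn (fun w : ℝ => Real.exp (-|l * (w + u)|))
        (fun w : ℝ => Real.exp (-(l * u)) * Real.exp (-(l * w))) (uIcc 0 t) := by
      intro w hw
      rw [uIcc_of_le ht] at hw
      simp only
      rw [abs_of_nonneg (mul_nonneg hl.le (add_nonneg hw.1 hu.1)), ← Real.exp_add]
      congr 1
      ring
    simp only
    rw [intervalIntegral.integral_congr h2, intervalIntegral.integral_const_mul,
      integral_exp_neg_mul hl.ne' 0 t]
    simp
  rw [intervalIntegral.integral_congr h1, intervalIntegral.integral_mul_const,
    integral_exp_neg_mul hl.ne' 0 s]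
  simp

/-- The cage-budget inequality for one rate `λ > 0`:
`(1 - e^{-λs})/λ · (1 - e^{-λt})/λ ≤ λ⁻²` (`s, t ≥ 0`). [folklore] -/
theorem closed_form_le_inv_sq {l s t : ℝ} (hl : 0 < l) (hs : 0 ≤ s) (ht : 0 ≤ t) :
    (1 - Real.exp (-(l * s))) / l * ((1 - Real.exp (-(l * t))) / l) ≤ l⁻¹ ^ 2 := by
  have ha : 0 ≤ 1 - Real.exp (-(l * s)) :=
    sub_nonneg.mpr (Real.exp_le_one_iff.mpr (neg_nonpos.mpr (mul_nonneg hl.le hs)))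
  have ha' : 1 - Real.exp (-(l * s)) ≤ 1 := by linarith [Real.exp_pos (-(l * s))]
  have hb : 0 ≤ 1 - Real.exp (-(l * t)) :=
    sub_nonneg.mpr (Real.exp_le_one_iff.mpr (neg_nonpos.mpr (mul_nonneg hl.le ht)))
  have hb' : 1 - Real.exp (-(l * t)) ≤ 1 := by linarith [Real.exp_pos (-(l * t))]
  rw [div_mul_div_comm, inv_pow, ← one_div, sq, div_le_div_iff_of_pos_right (by positivity)]
  exact mul_le_one₀ ha' hb hb'

/-- **Stub A2 `stub_bernsteinKernel` (registered signature, verbatim): continuity and `H₋₂` cage budget of the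
Bernstein (return-flow) kernel.**  For a finite measure `m` on `ℝ` carried by `(0,∞)` with `λ⁻² ∈ L¹(m)`, the kernel
`K(w) = ∫ e^{−λ|w|} dm(λ)` is continuous and `∫₀ˢ ∫ᵤ^{u+t} K ≤ ∫ λ⁻² dm` for all `s, t ≥ 0` (Tonelli and
`∫₀ˢ∫₀ᵗ e^{−λ(w+u)} = (1−e^{−λs})(1−e^{−λt})λ⁻² ≤ λ⁻²`). [folklore] -/
theorem stub_bernsteinKernel :
    ∀ m : Measure ℝ, IsFiniteMeasure m → (∀ᵐ l ∂m, 0 < l) →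
      Integrable (fun l : ℝ => l⁻¹ ^ 2) m →
    Continuous (fun w : ℝ => ∫ l, Real.exp (-(l * |w|)) ∂m) ∧
    ∀ s t : ℝ, 0 ≤ s → 0 ≤ t →
      ∫ u in (0:ℝ)..s, ∫ w in u..(u + t), (∫ l, Real.exp (-(l * |w|)) ∂m) ≤ ∫ l, l⁻¹ ^ 2 ∂m := by
  intro m hfin hpos hint
  have hK : ∀ w : ℝ, ∫ l, Real.exp (-(l * |w|)) ∂m = ∫ l, Real.exp (-|l * w|) ∂m := fun w =>
    integral_congr_ae (by
      filter_upwards [hpos] with l hl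
      rw [abs_mul, abs_of_pos hl])
  simp_rw [hK]
  refine ⟨continuous_kernel m, fun s t hs ht => ?_⟩
  simp_rw [integral_window_shift _ _ t, inner_swap m ht]
  rw [outer_swap m hs ht]
  refine integral_mono_of_nonneg (Eventually.of_forall fun l => ?_) hint ?_
  · exact intervalIntegral.integral_nonneg hs fun u _ =>
      intervalIntegral.integral_nonneg ht fun w _ => (Real.exp_pos _).le
  · filter_upwards [hpos] with l hl
    rw [double_integral_closed_form hl hs ht]
    exact closed_form_le_inv_sq hl hs ht

end Summit.AtomisticToContinuum.FouriersLaw.Theorems.QuasiSuperadditiveHeatVariance.ReturnFlowBernstein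

end
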